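import Summits.MatrixMultiplication.OmegaCensus.STPPCriticalPairsZ46Steps
import Summits.MatrixMultiplication.OmegaCensus.STPPKill223332332Z46NF

/-!
# ω-census (abelian STPP census): `{(2,2,3),(3,3,2),(3,3,2)}` in `ℤ/46ℤ`, all-progression branch — the cross steps coincide: `e₂ = ±d₁`, `d₂ = ±e₁` (kernel)

HONEST FRAMING (pub-omega census; verbatim): lottery ticket; floor = certified bounds/negative ranges.
Census STRUCTURE (seat pub-omega-stpp-2 gen 32, 2026-08-30), family (b2); first step of BRANCH I of HOME `pub-omega-stpp-2-g32/CASEMAP.md` §6.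
In the all-progression branch (`blockA/B/C_structure`, progression alternatives) write `Aᵢ = 3-AP(dᵢ)`, `Bᵢ = 3-AP(eᵢ)` (`i = 1, 2`), with
`Y°₁ = ⋃_{k≠1}(C_k − B_k)` a `12`-progression of step `d₁` and `Z°₂ = ⋃_{k≠2}(C_k − A_k)` a `12`-progression of step `e₂`.  Since `Y₂ = C₂ − B₂ ⊆ Y°₁` contains the
`3`-progression `c − b − 2e₂, c − b − e₂, c − b` of step `e₂`, `step_of_ap3_subset_12` gives `e₂ = ±m d₁` (`m ≤ 5`); since `Z₁ = C₁ − A₁ ⊆ Z°₂` contains a `3`-progression of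
step `d₁`, `d₁ = ±m′ e₂`; hence **`e₂ = ±d₁`** (`cross_step_eq`), and symmetrically `d₂ = ±e₁`.  Nothing here is progress on `ω`.

References: H. Cohn, R. Kleinberg, B. Szegedy, C. Umans, FOCS 2005 (arXiv:math/0511460), Def. 5.1; Nathanson GTM 165 §2.5 (tree `apFinset`).
-/

open Finset
open scoped Pointwise

namespace Summit.MatrixMultiplication.OmegaCensus.Z46

open Literature.Computability.AlgebraicComplexity
open Literature.Combinatorics.Additive
open Summit.MatrixMultiplication.OmegaCensus.STPPKneser
open Summit.MatrixMultiplication.OmegaCensus.CubeNB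

variable {A B C : Fin 3 → Finset (ZMod 46)}

/-- A `3`-progression of step `e` read off `F j − E j`: if `E j = {b, b + e, b + 2e}` (as `apFinset b e 3`) and `c ∈ F j`, then `c − (b + 2e), c − (b + e), c − b ∈ D E F j`.
[folklore] -/
theorem ap3_mem_D {E F : Fin 3 → Finset (ZMod 46)} {j : Fin 3} {b e c : ZMod 46} (hE : E j = apFinset b e 3) (hc : c ∈ F j) :
    c - (b + 2 • e) ∈ D E F j ∧ c - (b + 2 • e) + e ∈ D E F j ∧ c - (b + 2 • e) + e + e ∈ D E F j := by
  have hm : ∀ i < 3, b + i • e ∈ E j := fun i hi => by rw [hE, mem_apFinset]; exact ⟨i, hi, rfl⟩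
  refine ⟨mem_D.2 ⟨b + 2 • e, hm 2 (by norm_num), c, hc, rfl⟩, mem_D.2 ⟨b + 1 • e, hm 1 (by norm_num), c, hc, ?_⟩,
    mem_D.2 ⟨b + 0 • e, hm 0 (by norm_num), c, hc, ?_⟩⟩
  · rw [one_nsmul, two_nsmul]; abel
  · rw [zero_nsmul, two_nsmul]; abel

/-- **Cross steps coincide.**  If `Y° = ⋃_{k ≠ i}(C_k − B_k)` (`12` elements) is a progression of step `d` with `2d ≠ 0`, `B_j` (`j ≠ i`, `3` elements) a progression of step
`e` with `2e ≠ 0`, and `Z°' = ⋃_{k ≠ j}(C_k − A_k)` (`12` elements) a progression of step `e` while `A_i` (`3` elements) is a progression of step `d`, then `e = d` or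
`e = −d`. [cite: CohnKleinbergSzegedyUmans2005, Def. 5.1] -/
theorem cross_step_eq {i j : Fin 3} (hij : i ≠ j) {d e : ZMod 46} (hd : 2 • d ≠ 0) (he : 2 • e ≠ 0)
    (hAi : IsAP (A i) d) (hA3 : #(A i) = 3) (hBj : IsAP (B j) e) (hB3 : #(B j) = 3)
    (hCi : (C i).Nonempty) (hCj : (C j).Nonempty)
    (hY : IsAP (DU B C (univ.erase i)) d) (hY12 : #(DU B C (univ.erase i)) = 12)
    (hZ : IsAP (DU A C (univ.erase j)) e) (hZ12 : #(DU A C (univ.erase j)) = 12) : e = d ∨ e = -d := by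
  have hd0 : d ≠ 0 := by rintro rfl; exact hd (by rw [nsmul_zero])
  have he0 : e ≠ 0 := by rintro rfl; exact he (by rw [nsmul_zero])
  -- `e = ±m d`
  obtain ⟨t, ht⟩ := hY
  rw [hY12] at ht
  obtain ⟨b, hb⟩ := hBj
  rw [hB3] at hb
  obtain ⟨c, hc⟩ := hCj
  obtain ⟨h0, h1, h2⟩ := ap3_mem_D hb hc
  have hjI : j ∈ univ.erase i := Finset.mem_erase.2 ⟨hij.symm, Finset.mem_univ _⟩
  have hsub : D B C j ⊆ DU B C (univ.erase i) := fun x hx => Finset.mem_biUnion.2 ⟨j, hjI, hx⟩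
  rw [ht] at hsub
  obtain ⟨m, hm1, hm5, hm⟩ := step_of_ap3_subset_12 hd he0 (hsub h0) (hsub h1) (hsub h2)
  -- `d = ±m' e`
  obtain ⟨r, hr⟩ := hZ
  rw [hZ12] at hr
  obtain ⟨a, ha⟩ := hAi
  rw [hA3] at ha
  obtain ⟨c', hc'⟩ := hCi
  obtain ⟨h0', h1', h2'⟩ := ap3_mem_D ha hc'
  have hiJ : i ∈ univ.erase j := Finset.mem_erase.2 ⟨hij, Finset.mem_univ _⟩
  have hsub' : D A C i ⊆ DU A C (univ.erase j) := fun x hx => Finset.mem_biUnion.2 ⟨i, hiJ, hx⟩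
  rw [hr] at hsub'
  obtain ⟨m', hm1', hm5', hm'⟩ := step_of_ap3_subset_12 he hd0 (hsub' h0') (hsub' h1') (hsub' h2')
  exact eq_or_eq_neg_of_mutual_multiple hd hm1 hm5 hm1' hm5' hm hm'

/-- **The all-progression branch of `{(2,2,3),(3,3,2),(3,3,2)} @ ℤ₄₆`: `e₂ = ±d₁` and `d₂ = ±e₁`.**  Hypotheses: the progression alternatives of `blockA_structure 1`,
`blockB_structure 2` (for `e₂ = ±d₁`) — the symmetric instance gives `d₂ = ±e₁`. [cite: CohnKleinbergSzegedyUmans2005, Def. 5.1] [cite: Kemperman1960, Thm 2.1] -/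
theorem cross_steps_223_332_332 (hS : IsSTPP A B C) (hA : ∀ i, #(A i) = ![2, 3, 3] i) (hB : ∀ i, #(B i) = ![2, 3, 3] i)
    (hC : ∀ i, #(C i) = ![3, 2, 2] i) {i j : Fin 3} (hi : i ≠ 0) (hj : j ≠ 0) (hij : i ≠ j) {d e : ZMod 46} (hd : 2 • d ≠ 0) (he : 2 • e ≠ 0)
    (hAi : IsAP (A i) d) (hY : IsAP (DU B C (univ.erase i)) d) (hBj : IsAP (B j) e) (hZ : IsAP (DU A C (univ.erase j)) e) : e = d ∨ e = -d := by
  have hAne : ∀ i, (A i).Nonempty := fun i => card_pos.1 (by rw [hA]; fin_cases i <;> simp)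
  have hBne : ∀ i, (B i).Nonempty := fun i => card_pos.1 (by rw [hB]; fin_cases i <;> simp)
  have hCne : ∀ i, (C i).Nonempty := fun i => card_pos.1 (by rw [hC]; fin_cases i <;> simp)
  have hA3 : #(A i) = 3 := by rw [hA]; fin_cases i <;> simp at hi ⊢
  have hB3 : #(B j) = 3 := by rw [hB]; fin_cases j <;> simp at hj ⊢
  have hY12 : #(DU B C (univ.erase i)) = 12 := by
    rw [card_DU_BC hS hAne]; fin_cases i <;> simp at hi ⊢ <;> simp only [hB, hC] <;> decide
  have hZ12 : #(DU A C (univ.erase j)) = 12 := by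
    rw [card_DU_AC hS hBne]; fin_cases j <;> simp at hj ⊢ <;> simp only [hA, hC] <;> decide
  exact cross_step_eq hij hd he hAi hA3 hBj hB3 (hCne i) (hCne j) hY hY12 hZ hZ12

end Summit.MatrixMultiplication.OmegaCensus.Z46
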